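import Summits.CriticalPhenomena.PercolationContinuityZ3.Theorems.Transplant.KNCellsStepsSubbox
import HarnessLib

/-!
# F8 (generic, LAG-1 ANCHORS) — the weighting `Wt` of (30) is a subbox weighting IN A SUBGRAPH STRUCTURE (for `X □ ℤ²`: the tube graph in which
# the face step `cond_of_step` and its elongated inner chains run; companion of `isSubbox_Wt` and `isSubbox_Wcor_graph`;
# design HOME/prim-bschramm-p2-g2/F8-DESIGN.md §9–§10)

builds on p205010 (kernel theorem, internal audit signed; external expert review pending) — nothing in this file uses p205010.
Lane `prim-bschramm`, seat `prim-bschramm-p2` (Corridor-over-levels); helper file (`--supports stmt-CriticalPhenomena-4575`).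

* **`isSubbox_Wt_graph`** — for `G' ≤ G` and `Dd ⊆ E_i ∪ E_{v,x} ∪ E_{x,y}` disjoint from `E_i ∪ E_{v,x} ∪ H^j`: if the `G`-edges inside `Dd` are
  `G'`-edges and every `G`-edge from a vertex of the region outside `Dd` into `Dd` is a `G'`-edge, then `Wt h e a a' du j o` is a subbox
  weighting of `G'` on `Dd`;
* `isSubbox_restrW_graph` — the same for `restrW Q (Wt …)` on `Dd ⊆ Q` (the inner chains of the elongated routes run under `Wt` restricted to the prism `Q`).
[cite: KozmaNitzan2024, §4 p. 17 (subbox), p. 30] [cite: GrimmettPercolation1999, §7.2]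
-/

noncomputable section

open MeasureTheory ProbabilityTheory
open scoped ENNReal Classical

namespace Summit.CriticalPhenomena.PercolationContinuityZ3.Theorems

namespace Transplant

namespace KNCells

open Literature.Probability.Percolation Literature.Probability.LatticeModels SimpleGraph GadgetSystem ProbeHistory HSiteScheme Contour

variable {V : Type*} [DecidableEq V]

namespace KSchA

variable {A : Type*} {G : SimpleGraph V} [G.LocallyFinite] {S : KSchA V A}
variable {h : ProbeHistory V} {e : Site 2 × MDir} {a a' : A} {du : MDir} {j : ℕ} {o : Finset (Sym2 V)}

/-- **`Wt` is a subbox weighting of a subgraph structure `G' ≤ G` on `Dd`.** [cite: KozmaNitzan2024, §4 p. 17, p. 30] -/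
theorem isSubbox_Wt_graph (G' : SimpleGraph V) [G'.LocallyFinite] (hle : G' ≤ G) {Dd : Finset V} (hD : Dd ⊆ S.Sx G h e a a' du)
    (hdis : Disjoint Dd (S.Vx G h ∪ S.Γ.Ewv a e.1 e.2 ∪ S.Γ.Stub a' (tgt e) du j))
    (hin : ∀ u ∈ Dd, ∀ v ∈ Dd, G.Adj u v → G'.Adj u v)
    (hout : ∀ v ∈ Dd, ∀ x ∈ S.Sx G h e a a' du, x ∉ Dd → G.Adj x v → G'.Adj x v) :
    KNLevels.IsSubbox G' (S.Wt G h e a a' du j o) S.p Dd := by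
  have hfresh : ∀ u ∈ Dd, ∀ z, s(u, z) ∉ S.Fj G h e a a' du j := fun u hu z =>
    not_mem_Fj_of_not_mem (Finset.disjoint_left.1 hdis hu)
  refine ⟨fun u hu v hv huv => ?_, fun u hu v hv hne huv => ?_, fun v hv hvb x hx => ?_⟩
  · have huv' : G.Adj u v := hle huv
    rw [Wt_apply_of_not_mem_Fj (mk_mem_wireSet_iff.2 ⟨Finset.mem_coe.2 (hD hu), Finset.mem_coe.2 (hD hv), huv'.ne⟩) (hfresh u hu v),
      KNLevels.lattW_apply, if_pos ((SimpleGraph.mem_edgeSet G).2 huv')]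
  · have huv' : ¬G.Adj u v := fun h' => huv (hin u hu v hv h')
    rw [Wt_apply_of_not_mem_Fj (mk_mem_wireSet_iff.2 ⟨Finset.mem_coe.2 (hD hu), Finset.mem_coe.2 (hD hv), hne⟩) (hfresh u hu v),
      KNLevels.lattW_apply, if_neg (fun h' => huv' ((SimpleGraph.mem_edgeSet G).1 h'))]
  · by_cases hxS : s(x, v) ∈ wireSet (↑(S.Sx G h e a a' du) : Set V)
    · have hxS' : x ∈ S.Sx G h e a a' du := Finset.mem_coe.1 (hxS.1 x (Sym2.mem_mk_left _ _))
      have hnadj : ¬G.Adj x v := fun hadj =>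
        hvb ((mem_innerBoundary_iff).2 ⟨hv, x, hx, (hout v hv x hxS' hx hadj).symm⟩)
      rw [Sym2.eq_swap, Wt_apply_of_not_mem_Fj (by rwa [Sym2.eq_swap]) (hfresh v hv x), KNLevels.lattW_apply,
        if_neg (fun h' => hnadj ((SimpleGraph.mem_edgeSet G).1 h').symm)]
    · exact Wt_apply_of_not_mem_wireSet hxS

omit [DecidableEq V] in
/-- **A restriction `restrW Q W` of a subbox weighting is a subbox weighting on every `Dd ⊆ Q`** (for the subgraph structure `G'`).
[cite: KozmaNitzan2024, §4 p. 17 (subbox), p. 22 (Ω)] -/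
theorem isSubbox_restrW_graph [DecidableEq V] (G' : SimpleGraph V) [G'.LocallyFinite] {W : Sym2 V → unitInterval} {p : unitInterval}
    {Q Dd : Finset V} (hDQ : Dd ⊆ Q) (hW : KNLevels.IsSubbox G' W p Dd) :
    KNLevels.IsSubbox G' (restrW (↑Q : Set V) W) p Dd := by
  refine ⟨fun u hu v hv huv => ?_, fun u hu v hv hne huv => ?_, fun v hv hvb x hx => ?_⟩
  · rw [restrW_apply_of_mem _ (mk_mem_wireSet_iff.2 ⟨Finset.mem_coe.2 (hDQ hu), Finset.mem_coe.2 (hDQ hv), huv.ne⟩)]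
    exact hW.adj u hu v hv huv
  · rw [restrW_apply_of_mem _ (mk_mem_wireSet_iff.2 ⟨Finset.mem_coe.2 (hDQ hu), Finset.mem_coe.2 (hDQ hv), hne⟩)]
    exact hW.nadj u hu v hv hne huv
  · by_cases hxQ : s(x, v) ∈ wireSet (↑Q : Set V)
    · rw [restrW_apply_of_mem _ hxQ]; exact hW.outside v hv hvb x hx
    · exact restrW_apply_of_not_mem _ hxQ

end KSchA

end KNCells

end Transplant

end Summit.CriticalPhenomena.PercolationContinuityZ3.Theorems

end
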